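import Mathlib
import Summits.ResolutionOfSingularities.ResolutionOfSingularities.Theses.TeissierJung
import Literature.AlgebraicGeometry.Resolution.TeissierPresentation
import Literature.AlgebraicGeometry.Resolution.TameQuotientSingularitiesResolution
import Literature.AlgebraicGeometry.Resolution.SurfaceResolutionReduction
import Summits.ResolutionOfSingularities.ResolutionOfSingularities.Theorems.TeissierJungTeissierResolveFiniteTypeGradeZero
import Summits.ResolutionOfSingularities.ResolutionOfSingularities.Theorems.TeissierJungTeissierResolveGradedEtaleBaseChange
import Summits.ResolutionOfSingularities.ResolutionOfSingularities.Theorems.TeissierJungTeissierResolveChartAssembly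
import Summits.ResolutionOfSingularities.ResolutionOfSingularities.Theorems.TeissierJungTeissierResolveClosedPointsSuffice
import Summits.ResolutionOfSingularities.ResolutionOfSingularities.Theorems.TeissierJungTeissierResolveBranchDictionary
import Summits.ResolutionOfSingularities.ResolutionOfSingularities.Theorems.TeissierJungTeissierResolveBranchFinite
import Summits.ResolutionOfSingularities.ResolutionOfSingularities.Theorems.TeissierJungTeissierResolveToricCompletion
import Summits.ResolutionOfSingularities.ResolutionOfSingularities.Theorems.TeissierJungTeissierResolveKLinearisation
import Literature.AlgebraicGeometry.Resolution.ArtinApproximation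
import HarnessLib

/-!
# `TeissierResolve` ⇐ toric normalisation + Bergh–Rydh 2019 + Artin 1969 (line `Sketch`: the reduction, sorry-free)

Support theorem for the crux `stmt-ResolutionOfSingularities-17086`
(`Summit.ResolutionOfSingularities.ResolutionOfSingularities.Theses.TeissierJung.TeissierResolve`:
every Teissier-presented scheme `X'` over an algebraically closed field of characteristic `p` has a
resolution of singularities). This file lands the line's REDUCTION unconditionally:

**Theorem** (`teissierResolve_of_toricNormalisation`). Assume
(1) `BerghRydh2019_diagonalizableQuotientResolution` (named fact, Bergh–Rydh 2019 Thm 5,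
    diagonalizable case: varieties over a perfect field with finite diagonalizable quotient
    singularities — étale charts `Spec S₀`, `S` smooth graded by a finite abelian group — admit a
    resolution);
(2) `Artin1969Corollary26` (named fact, Artin 1969 Cor. 2.6: `k`-isomorphic completed local rings
    of finite-type `k`-schemes give a common étale neighbourhood);
(3) TORIC NORMALISATION of Teissier branches (the line's research statement, a HYPOTHESIS here,
    stated inline as `hT`): over an algebraically closed `k` of characteristic `p`, the
    normalisation of a Teissier-presented domain, module-finite over `k⟦x₁..x_d⟧`, is
    ring-isomorphic to the completion of a simplicial toric ring `k[y₁..y_{d'}]₀` (degree-`0` part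
    for weights into a finite abelian group) at its irrelevant ideal.
Then `TeissierResolve` holds.

Proof (all the plumbing is landed in the imported sibling files): for `X'` with `TF X'`, the
normalisation `X'^ν → X'` is finite birational (E. Noether), so it suffices to resolve `X'^ν`
(`Scheme.HasResolution.of_normalization`); at a closed point `y ↦ x`, `𝒪̂_{X'^ν,y}` is the
normalisation of an analytic branch `𝒪̂_{X',x} ⧸ P` (`BranchDictionary`), which is
Teissier-presented (`TF`) and module-finite over `k⟦x⟧` (`BranchFinite`), hence by (3) a completed
simplicial toric ring, `k`-linearly after a semilinear twist (`KLinearisation`), i.e. the completed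
stalk of the toric variety `Spec k[y]₀` at its cone point (`ToricCompletion`); (2) turns this formal
model into an étale chart of Bergh–Rydh shape (`ChartAssembly`, with `FiniteTypeGradeZero`,
`GradedEtaleBaseChange`), charts at closed points suffice (`ClosedPointsSuffice`), and (1) resolves
`X'^ν`. This is the honest ceiling of line `Sketch` (`Cruxes/TeissierResolve/Lines/Sketch.lean`):
the crux is reduced to ONE local-algebra statement (3), for which no printed source exists in
characteristic `p` (characteristic `0`, quasi-ordinary germs: González Pérez, "the normalisation of
a quasi-ordinary singularity is the toric singularity `ℂ{σ^∨ ∩ M}` of its lattice", quoted as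
Lemma 2.4 of arXiv:2511.09126; Popescu-Pampu), plus two printed theorems. Everything here is
[folklore] plumbing; no definitions, no new named facts.
-/

noncomputable section

set_option linter.dupNamespace false -- mandated namespace of this single-conjunct summit

open CategoryTheory AlgebraicGeometry TopologicalSpace IsLocalRing
open Literature.AlgebraicGeometry.Resolution

universe u

namespace Summit.ResolutionOfSingularities.ResolutionOfSingularities.Theorems.TeissierResolve.OfToricNormalisation

attribute [local instance] MvPolynomial.weightedGradedAlgebra

/-! ## The formal model of the normalisation, from toric normalisation of the branches -/

/-- C⁺ at scheme level, from toric normalisation of the branches (`hT`): at every closed point `y` of the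
normalisation of a Teissier-presented `X'` over an algebraically closed field `k` of
characteristic `p`, the completed local ring `𝒪̂_{X'^ν,y}` is `k`-isomorphic to the completed
local ring, at some point, of `Spec S₀` for `S = k[y₁..y_{d'}]` graded by a finite abelian group
(formally a diagonalizable quotient singularity). Assembly: `y ↦ x` closed (finite maps are
closed); `stub_branchDictionary` (𝒪̂_{X'^ν,y} ≅ normalisation of the branch `𝒪̂_{X',x} ⧸ P`);
`TF` at `(x, P)` (presentation `ι`, compatibility); `stub_branchFinite` (the branch is module-finite
over `k⟦x⟧` through `ι`); `hT` (normalised branch ≅ completed toric ring); `stub_kLinearisation`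
(make it `k`-linear); `stub_toricCompletion` (≅ completed stalk of the toric variety). [folklore] -/
theorem formalDiagonalizableQuotient_of_toricNormalisation
    (hT : ∀ {p : ℕ} [Fact p.Prime] (k : Type) [Field k] [CharP k p]
      [IsAlgClosed k] (d : ℕ) (B : Type) [CommRing B] [IsDomain B]
      [Algebra (MvPowerSeries (Fin d) k) B] [Module.Finite (MvPowerSeries (Fin d) k) B],
      TeissierPresentation k d B (algebraMap (MvPowerSeries (Fin d) k) B) →
      ∃ (d' : ℕ) (A : Type) (_ : AddCommGroup A) (_ : Finite A) (_ : DecidableEq A)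
        (deg : Fin d' → A),
        Nonempty (integralClosure B (FractionRing B) ≃+*
          AdicCompletion
            (RingHom.ker (MvPolynomial.constantCoeff.comp
              (algebraMap (MvPolynomial.weightedHomogeneousSubmodule k deg 0)
                (MvPolynomial (Fin d') k))))
            (MvPolynomial.weightedHomogeneousSubmodule k deg 0)))
    {p : ℕ} [Fact p.Prime] {k : Type} [Field k] [CharP k p]
    [IsAlgClosed k] (X' : Scheme.{0}) [IsIntegral X'] (hX' : TeissierPresented k X')
    (f : X' ⟶ Spec (.of k)) [LocallyOfFiniteType f] [QuasiCompact f] [IsSeparated f]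
    (y : normalization X') (hy : IsClosed ({y} : Set (normalization X'))) :
    ∃ (A : Type) (_ : AddCommGroup A) (_ : Finite A) (_ : DecidableEq A)
      (S : Type) (_ : CommRing S) (_ : Algebra k S) (𝒮 : A → Submodule k S) (_ : GradedAlgebra 𝒮),
      Algebra.FiniteType k S ∧ Algebra.Smooth k S ∧
      ∃ (t : Spec (.of (𝒮 0)))
        (e : AdicCompletion (maximalIdeal ((normalization X').presheaf.stalk y))
              ((normalization X').presheaf.stalk y) ≃+*
            AdicCompletion (maximalIdeal ((Spec (.of (𝒮 0))).presheaf.stalk t))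
              ((Spec (.of (𝒮 0))).presheaf.stalk t)),
        ∀ a : k,
          e (algebraMap _ _ (((normalization X').presheaf.germ ⊤ y trivial).hom
              ((normalizationι X' ≫ f).appTop.hom ((Scheme.ΓSpecIso (.of k)).inv.hom a)))) =
            algebraMap _ _ (((Spec (.of (𝒮 0))).presheaf.germ ⊤ t trivial).hom
              ((Spec.map (CommRingCat.ofHom (algebraMap k (𝒮 0)))).appTop.hom
                ((Scheme.ΓSpecIso (.of k)).inv.hom a))) := by
  classical
  -- the structure morphism of the normalisation
  haveI : IsFinite (normalizationι X') :=
    isFinite_normalizationι X' NoetherFiniteIntegralClosure_holds f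
  let fn : normalization X' ⟶ Spec (.of k) := normalizationι X' ≫ f
  haveI hfn₁ : LocallyOfFiniteType fn := inferInstance
  haveI hfn₂ : QuasiCompact fn := inferInstance
  -- (D) the dictionary: `𝒪̂_{X'^ν,y}` is the normalisation of a branch at `x := ν y`
  obtain ⟨P, hPmin, E_D, -⟩ := BranchDictionary.stub_branchDictionary X' f y hy
  -- `x` is a closed point
  have hx : IsClosed ({(normalizationι X').base y} : Set X') := by
    have := (normalizationι X').isClosedMap _ hy
    simpa [Set.image_singleton] using this
  -- (TF) the Teissier presentation of the branch `𝒪̂_{X',x} ⧸ P`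
  obtain ⟨S, g, π, _, hlft, hqc, _, _, _, hfin, hbr⟩ := hX'
  obtain ⟨d, φ, ι, hpres, hι⟩ := hbr _ hx P hPmin
  -- (F) the branch is module-finite over `k⟦x⟧` through `ι`
  haveI : IsLocallyNoetherian X' := LocallyOfFiniteType.isLocallyNoetherian f
  haveI : IsLocallyNoetherian S := LocallyOfFiniteType.isLocallyNoetherian g
  letI := ι.toAlgebra
  haveI hfinB := BranchFinite.stub_branchFinite π _ P d φ ι hpres hι
  -- the branch is a domain (`P` is prime)
  haveI : P.IsPrime := hPmin.1.1
  -- (T) toric normalisation of the branch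
  obtain ⟨d', A, _, _, _, deg, ⟨E_T⟩⟩ :=
    hT (p := p) k d (AdicCompletion (maximalIdeal (X'.presheaf.stalk
      ((normalizationι X').base y))) (X'.presheaf.stalk ((normalizationι X').base y)) ⧸ P) hpres
  -- (K) make the composite iso `k`-linear
  obtain ⟨E₂, hE₂⟩ :=
    KLinearisation.stub_kLinearisation (p := p) (normalization X') fn y hy d' A deg (E_D.trans E_T)
  -- (C) the completed toric ring is the completed stalk of the toric variety
  obtain ⟨t, E_C, hE_C⟩ := ToricCompletion.stub_toricCompletion k d' A deg
  refine ⟨A, inferInstance, inferInstance, inferInstance, MvPolynomial (Fin d') k, inferInstance,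
    inferInstance, MvPolynomial.weightedHomogeneousSubmodule k deg, inferInstance, inferInstance,
    ⟨inferInstance, inferInstance⟩, t, E₂.trans E_C, fun a => ?_⟩
  rw [RingEquiv.trans_apply, hE₂ a, hE_C a]




/-! ## The reduction -/

/-- **`TeissierResolve` ⇐ toric normalisation + Bergh–Rydh 2019 Thm 5 + Artin 1969 Cor 2.6.**
Under the two named facts and the toric-normalisation hypothesis `hT` (see the module docstring),
every Teissier-presented scheme over an algebraically closed field of characteristic `p` has a
resolution of singularities: Bergh–Rydh charts on the normalisation (from
`formalDiagonalizableQuotient_of_toricNormalisation` through Artin's Cor. 2.6), Bergh–Rydh's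
theorem, and descent of resolutions along the finite birational normalisation. [folklore] -/
theorem teissierResolve_of_toricNormalisation (hBR : BerghRydh2019_diagonalizableQuotientResolution)
    (hA : Artin1969Corollary26.{0})
    (hT : ∀ {p : ℕ} [Fact p.Prime] (k : Type) [Field k] [CharP k p]
      [IsAlgClosed k] (d : ℕ) (B : Type) [CommRing B] [IsDomain B]
      [Algebra (MvPowerSeries (Fin d) k) B] [Module.Finite (MvPowerSeries (Fin d) k) B],
      TeissierPresentation k d B (algebraMap (MvPowerSeries (Fin d) k) B) →
      ∃ (d' : ℕ) (A : Type) (_ : AddCommGroup A) (_ : Finite A) (_ : DecidableEq A)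
        (deg : Fin d' → A),
        Nonempty (integralClosure B (FractionRing B) ≃+*
          AdicCompletion
            (RingHom.ker (MvPolynomial.constantCoeff.comp
              (algebraMap (MvPolynomial.weightedHomogeneousSubmodule k deg 0)
                (MvPolynomial (Fin d') k))))
            (MvPolynomial.weightedHomogeneousSubmodule k deg 0))) :
    Summit.ResolutionOfSingularities.ResolutionOfSingularities.Theses.TeissierJung.TeissierResolve := by
  intro p hp k _ _ _ TF X' hTF
  haveI : Fact p.Prime := ⟨hp⟩
  have hX' : TeissierPresented k X' := (teissierPresented_iff k X').2 hTF
  obtain ⟨S, g, π, hsep, hlft, hqc, _, _, hfin⟩ := hX'.exists_isFinite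
  haveI := hsep; haveI := hlft; haveI := hqc; haveI := hfin
  haveI : IsIntegral X' := hX'.isIntegral
  -- the structure morphism of `X'`
  let f : X' ⟶ Spec (.of k) := π ≫ g
  haveI hf₁ : LocallyOfFiniteType f := inferInstance
  haveI hf₂ : QuasiCompact f := inferInstance
  haveI hf₃ : IsSeparated f := inferInstance
  -- the normalisation and its structure morphism
  haveI : IsFinite (normalizationι X') :=
    isFinite_normalizationι X' NoetherFiniteIntegralClosure_holds f
  let fn : normalization X' ⟶ Spec (.of k) := normalizationι X' ≫ f
  haveI hfn₁ : LocallyOfFiniteType fn := inferInstance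
  haveI hfn₂ : QuasiCompact fn := inferInstance
  haveI hfn₃ : IsSeparated fn := inferInstance
  haveI : PerfectField k := inferInstance
  refine Scheme.HasResolution.of_normalization (X := X') f (hBR k (normalization X') fn ?_)
  refine ClosedPointsSuffice.stub_closedPointsSuffice (normalization X') fn ?_
  intro y hy
  obtain ⟨A, _, _, _, T, _, _, 𝒯, _, hTft, hTsm, t, e, he⟩ :=
    formalDiagonalizableQuotient_of_toricNormalisation hT (p := p) X' hX' f y hy
  exact ChartAssembly.stub_chartAssembly hA FiniteTypeGradeZero.stub_finiteType_gradeZero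
    GradedEtaleBaseChange.stub_gradedEtaleBaseChange (normalization X') fn y A T 𝒯 t e he

end Summit.ResolutionOfSingularities.ResolutionOfSingularities.Theorems.TeissierResolve.OfToricNormalisation

end
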